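import Summits.MatrixMultiplication.OmegaCensus.GoldenCyclic

/-!
# ω-census, family (b3): the golden groups — the action of the powers of `ζ` on `𝔽_p[ζ₅]` and on a Thue pair

HONEST FRAMING (pub-omega census; verbatim): lottery ticket; floor = certified bounds/negative ranges.
Census BOOKKEEPING (conjecture C9 of the cell; pub-omega stpp-1 gen 21).  Arithmetic for the successor's uniform theorem on
`GoldCyc p τ = 𝔽_p[ζ] ⋊ ℤ/5` (`GoldenCyclic.lean`, `τ² + τ = 1`): the five products `ζ^s · (A + Bζ)` in closed form
(`gz_pow_mul_0 … gz_pow_mul_4`: `(A,B) ↦ (A,B), (−B, A+τB), (−A−τB, τA−τB), (τB−τA, −τA−B), (τA+B, −A)`), the same through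
`RCyc.act gz s` (`act_gz_mul`, by cases on `s : ZMod 5`), and the INTEGRALITY that makes the phase-block method work with `√p`
errors: if `τX = Y` (a Thue pair `(x, y ≡ τx)` divided by `8`) then `τY = X − Y` (`tau_mul_thue`) and every product
`ζ^s · (X + 0ζ)` has coordinates in `{0, ±X, ±Y}` (`act_gz_mul_thue`: `(X,0), (0,X), (−X,Y), (−Y,−Y), (Y,−X)`), matching the
coefficient table of HOME/pub-omega-stpp-1-g21/ATOMS-NONNILPOTENT-C9.md (seat numerics `code/golden.py`).  Nothing here is
progress on `ω`.
-/

namespace Summit.MatrixMultiplication.OmegaCensus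

namespace Gold

variable {p : ℕ} {τ : ZMod p}

/-- `ζ·(A + Bζ) = −B + (A + τB)ζ` (left multiplication). [folklore] -/
theorem gz_mul (A B : ZMod p) : gz * (⟨A, B⟩ : Gold p τ) = ⟨-B, A + τ * B⟩ := by
  rw [mul_comm]; exact mul_gz A B

/-- `ζ⁰·(A + Bζ)`. [folklore] -/
theorem gz_pow_mul_0 (A B : ZMod p) : (gz : Gold p τ) ^ 0 * ⟨A, B⟩ = ⟨A, B⟩ := by rw [pow_zero, one_mul]

/-- `ζ¹·(A + Bζ) = −B + (A + τB)ζ`. [folklore] -/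
theorem gz_pow_mul_1 (A B : ZMod p) : (gz : Gold p τ) ^ 1 * ⟨A, B⟩ = ⟨-B, A + τ * B⟩ := by rw [pow_one, gz_mul]

/-- `ζ²·(A + Bζ) = (−A − τB) + (τA − τB)ζ` (using `τ² + τ = 1`). [folklore] -/
theorem gz_pow_mul_2 (hτ : τ ^ 2 + τ = 1) (A B : ZMod p) :
    (gz : Gold p τ) ^ 2 * ⟨A, B⟩ = ⟨-A - τ * B, τ * A - τ * B⟩ := by
  rw [pow_succ, mul_assoc, gz_mul, pow_one, gz_mul]
  ext
  · simp only
    ring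
  · simp only
    linear_combination B * hτ

/-- `ζ³·(A + Bζ) = τ(B − A) + (−τA − B)ζ`. [folklore] -/
theorem gz_pow_mul_3 (hτ : τ ^ 2 + τ = 1) (A B : ZMod p) :
    (gz : Gold p τ) ^ 3 * ⟨A, B⟩ = ⟨τ * B - τ * A, -τ * A - B⟩ := by
  rw [pow_succ, mul_assoc, gz_mul, gz_pow_mul_2 hτ]
  ext
  · simp only
    linear_combination (-B) * hτ
  · simp only
    linear_combination (-B) * hτ

/-- `ζ⁴·(A + Bζ) = (τA + B) − Aζ`. [folklore] -/
theorem gz_pow_mul_4 (hτ : τ ^ 2 + τ = 1) (A B : ZMod p) :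
    (gz : Gold p τ) ^ 4 * ⟨A, B⟩ = ⟨τ * A + B, -A⟩ := by
  rw [pow_succ, mul_assoc, gz_mul, gz_pow_mul_3 hτ]
  ext
  · simp only
    linear_combination B * hτ
  · simp only
    ring

/-- All elements of `ZMod 5` are `0 … 4`. [folklore] -/
theorem zmod5_cases : ∀ k : ZMod 5, k = 0 ∨ k = 1 ∨ k = 2 ∨ k = 3 ∨ k = 4 := by decide

/-- The coordinates of `ζ^s · (A + Bζ)` for `s : ZMod 5` (the `RCyc` action). [folklore] -/
theorem act_gz_mul (hτ : τ ^ 2 + τ = 1) (s : ZMod 5) (A B : ZMod p) :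
    RCyc.act (gz : Gold p τ) s * ⟨A, B⟩ =
      (![⟨A, B⟩, ⟨-B, A + τ * B⟩, ⟨-A - τ * B, τ * A - τ * B⟩, ⟨τ * B - τ * A, -τ * A - B⟩, ⟨τ * A + B, -A⟩] :
        Fin 5 → Gold p τ) s := by
  unfold RCyc.act
  rcases zmod5_cases s with rfl | rfl | rfl | rfl | rfl
  · exact gz_pow_mul_0 A B
  · rw [show (1 : ZMod 5).val = 1 from rfl]; exact gz_pow_mul_1 A B
  · exact gz_pow_mul_2 hτ A B
  · exact gz_pow_mul_3 hτ A B
  · exact gz_pow_mul_4 hτ A B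

/-- INTEGRALITY of the Thue pair: `τX = Y` gives `τY = X − Y` (from `τ² = 1 − τ`). [folklore] -/
theorem tau_mul_thue (hτ : τ ^ 2 + τ = 1) {X Y : ZMod p} (h : τ * X = Y) : τ * Y = X - Y := by
  rw [← h]
  linear_combination X * hτ

/-- The five products `ζ^s · X` (`X ∈ 𝔽_p ⊂ 𝔽_p[ζ]`) of a Thue pair `τX = Y`: coordinates in `{0, ±X, ±Y}`. [folklore] -/
theorem act_gz_mul_thue (hτ : τ ^ 2 + τ = 1) {X Y : ZMod p} (h : τ * X = Y) (s : ZMod 5) :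
    RCyc.act (gz : Gold p τ) s * ⟨X, 0⟩ = (![⟨X, 0⟩, ⟨0, X⟩, ⟨-X, Y⟩, ⟨-Y, -Y⟩, ⟨Y, -X⟩] : Fin 5 → Gold p τ) s := by
  rw [act_gz_mul hτ]
  rcases zmod5_cases s with rfl | rfl | rfl | rfl | rfl <;> (ext <;> simp [h])

end Gold

end Summit.MatrixMultiplication.OmegaCensus
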